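import Mathlib.RingTheory.Nilpotent.Exp
import HarnessLib

/-!
# Venture HSemireg — the class bookkeeping of the untwisting step (route R1.0 (ii)): Markman's
# `κ = exp(-c₁/r) · ch` is invariant under a line-bundle twist, and the twist with `r · c₁(L) = -c₁(E)`
# has `c₁ = 0` and `ch = κ(E)`

HONEST FRAMING. Pure commutative algebra in an abstract commutative `ℚ`-algebra `H` (read: the even rational
cohomology `H^{2•}(X₀, ℚ)` of a smooth projective variety, where positive-degree classes are nilpotent),
companion of `UntwistFullSigma.lean` (the kernel clause R1.0 (iii)). Nothing is asserted about any variety,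
no Chern character is constructed, and nothing here says HC, HC_CM or HC_AV is proved. The DICTIONARY
`ch(E ⊗ L) = ch(E) · exp(c₁(L))`, `c₁(E ⊗ L) = c₁(E) + rk(E) · c₁(L)` (multiplicativity of the Chern
character, `ch(L) = exp c₁(L)`) is how the hypotheses `ch' = ch * exp l`, `c' = c + r • l` below are MEANT to be
instantiated; it is not proved here (no Chern character of a perfect complex on the tree's carriers).

## The step served (cell pub-hsemireg, `general-structure/PERRY-SUBSTITUTE-GS.md` §1 (R1.0); gs-red RED-GS.md
## GS-23(e); numbers by value, for orientation only)

`E₀ = Φ(I_p ⊠ I_q)` on the abelian fourfold `X₀ = X × X̂`, rank `r = -2`, `c₁(E₀) = c₁(P)` (`P` the Poincaré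
bundle), `κ(E₀) := exp(-c₁(E₀)/r) · ch(E₀) = exp(c₁(P)/2) · ch(E₀)` (Markman's class, Hodge in every degree
along the Weil family, Cor. 1.3.2 of [Markman2025SecantWeil]); on the `μ₂`-gerbe of square roots of `P` the
tautological root `L` has `c₁(L) = c₁(P)/2`, so `r · c₁(L) = -c₁(P) = -c₁(E₀)`, and the untwisted object
`E₀′ = π^*E₀ ⊗ L` has `c₁(E₀′) = c₁(E₀) + r c₁(L) = 0` and `ch(E₀′) = ch(E₀) exp(c₁(L)) = κ(E₀)`
(R1.0 (ii); gs-red GS-23(e): «sign check: `-c₁/r = +c₁(P)/2` ✓»). Markman, arXiv:2502.03415 §1.3 (held text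
p0005 L61–62): «`κ(ch) = exp(-ch₁/r) ch` … `κ(E) := κ(ch(E))`»; §7.3 (p0037 L7–8): «replace `𝓑` with a
twisted sheaf `𝓑′` with trivial determinant, which is the tensor product of `𝓑` with a twisted line bundle.
The sheaf `𝓑′` satisfies `κ(𝓑) = κ(𝓑′)` and … `κ(𝓑′) = ch(𝓑′)`».

## Contents (everything proved; 0 named facts; no definitions — `κ` is written out as
## `IsNilpotent.exp (-(r⁻¹ • c)) * ch`, Mathlib's exponential of a nilpotent element)

* `exp_neg_smul_mul_twist_eq` — **`κ` is twist-invariant**: for `c`, `l` nilpotent and `r ≠ 0`,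
  `exp(-(r⁻¹ • (c + r • l))) * (ch * exp l) = exp(-(r⁻¹ • c)) * ch`, i.e. `κ(r, c + r l, ch · e^l) = κ(r, c, ch)`.
* `twist_firstChern_eq_zero_of_smul_eq_neg`, `twist_ch_eq_kappa_of_smul_eq_neg` — **the untwisting twist**:
  if `r • l = -c` then `c + r • l = 0` and `ch * exp l = exp(-(r⁻¹ • c)) * ch` (`= κ`).
* `neg_two_smul_half_smul` — the numeric instance of R1.0: `r = -2`, `l = (1/2) • c` satisfies `r • l = -c`
  (`c = c₁(P) = c₁(E₀)`, `l = c₁(L) = c₁(P)/2`), whence `twist_ch_eq_kappa_rank_neg_two`: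
  `ch * exp((1/2) • c) = exp(-((-2)⁻¹ • c)) * ch`.

## References

* E. Markman, *Cycles on abelian 2n-folds of Weil type from secant sheaves on abelian n-folds*,
  arXiv:2502.03415, §1.3 (the class `κ`), Cor. 1.3.2, §7.3. [Markman2025SecantWeil]
-/

namespace Summit.Ventures.HSemireg

section KappaClass

variable {H : Type*} [CommRing H] [Algebra ℚ H]

/-- **Markman's class `κ(E) = exp(-c₁(E)/rk E) · ch(E)` is invariant under twisting by a line bundle**
(abstract form): in a commutative `ℚ`-algebra, for nilpotent `c` (`= c₁(E)`) and `l` (`= c₁(L)`) and a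
non-zero rational `r` (`= rk E`), with `c' = c + r • l` (`= c₁(E ⊗ L)`) and `ch' = ch * exp l`
(`= ch(E ⊗ L)`): `exp(-(r⁻¹ • c')) * ch' = exp(-(r⁻¹ • c)) * ch`. (Markman: «`𝓑′` … the tensor product of
`𝓑` with a twisted line bundle … satisfies `κ(𝓑) = κ(𝓑′)`».) [cite: Markman2025SecantWeil, §1.3 and §7.3] -/
theorem exp_neg_smul_mul_twist_eq {c l : H} (hc : IsNilpotent c) (hl : IsNilpotent l) {r : ℚ} (hr : r ≠ 0)
    (ch : H) :
    IsNilpotent.exp (-(r⁻¹ • (c + r • l))) * (ch * IsNilpotent.exp l) =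
      IsNilpotent.exp (-(r⁻¹ • c)) * ch := by
  have h1 : -(r⁻¹ • (c + r • l)) = -(r⁻¹ • c) + -l := by
    rw [smul_add, smul_smul, inv_mul_cancel₀ hr, one_smul, neg_add]
  rw [h1, IsNilpotent.exp_add_of_commute (Commute.all _ _) (hc.smul r⁻¹).neg hl.neg]
  calc IsNilpotent.exp (-(r⁻¹ • c)) * IsNilpotent.exp (-l) * (ch * IsNilpotent.exp l)
      = IsNilpotent.exp (-(r⁻¹ • c)) * ch * (IsNilpotent.exp (-l) * IsNilpotent.exp l) := by ring
    _ = IsNilpotent.exp (-(r⁻¹ • c)) * ch := by rw [IsNilpotent.exp_neg_mul_exp_self hl, mul_one]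

/-- **The untwisting twist kills `c₁`**: if `r • l = -c` (`rk E · c₁(L) = -c₁(E)`; for R1.0: `r = -2`,
`c = c₁(P)`, `l = c₁(P)/2`) then `c + r • l = 0` (`c₁(E ⊗ L) = 0`). [cite: Markman2025SecantWeil, §7.3] -/
theorem twist_firstChern_eq_zero_of_smul_eq_neg {c l : H} {r : ℚ} (hrl : r • l = -c) : c + r • l = 0 := by
  rw [hrl, add_neg_cancel]

/-- **The untwisting twist turns `ch` into `κ`**: if `r ≠ 0` and `r • l = -c`, then
`ch * exp l = exp(-(r⁻¹ • c)) * ch`, i.e. `ch(E ⊗ L) = κ(E)` (Markman §7.3: «`κ(𝓑′) = ch(𝓑′)`» for the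
trivial-determinant twist; R1.0 (ii): `ch(E₀′) = κ(E₀)`). No nilpotency is needed for this identity.
[cite: Markman2025SecantWeil, §7.3] -/
theorem twist_ch_eq_kappa_of_smul_eq_neg {c l : H} {r : ℚ} (hr : r ≠ 0) (hrl : r • l = -c) (ch : H) :
    ch * IsNilpotent.exp l = IsNilpotent.exp (-(r⁻¹ • c)) * ch := by
  have hl : l = -(r⁻¹ • c) := by
    rw [← neg_neg c, ← hrl, smul_neg, smul_smul, inv_mul_cancel₀ hr, one_smul, neg_neg]
  rw [hl, mul_comm]

/-- **The numbers of R1.0**: rank `r = -2` and the tautological root `L` of `P` on the `μ₂`-gerbe,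
`c₁(L) = c₁(P)/2`, satisfy `r • c₁(L) = -c₁(P)`: `(-2) • ((1/2) • c) = -c`. [folklore] -/
theorem neg_two_smul_half_smul (c : H) : (-2 : ℚ) • ((1 / 2 : ℚ) • c) = -c := by
  rw [smul_smul, show (-2 : ℚ) * (1 / 2) = -1 by norm_num, neg_one_smul]

/-- **R1.0 (ii) for the STEP-0 (C) object, abstract form**: with `c = c₁(P) = c₁(E₀)`, rank `-2` and the
twist `l = (1/2) • c = c₁(L)`: `ch * exp((1/2) • c) = exp(-((-2)⁻¹ • c)) * ch`, i.e.
`ch(π^*E₀ ⊗ L) = exp(c₁(P)/2) · ch(E₀) = κ(E₀)`, and `c + (-2) • l = 0` (`c₁(E₀′) = 0`).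
[cite: Markman2025SecantWeil, §1.3 and §7.3] -/
theorem twist_ch_eq_kappa_rank_neg_two (c ch : H) :
    ch * IsNilpotent.exp ((1 / 2 : ℚ) • c) = IsNilpotent.exp (-((-2 : ℚ)⁻¹ • c)) * ch ∧
      c + (-2 : ℚ) • ((1 / 2 : ℚ) • c) = 0 :=
  ⟨twist_ch_eq_kappa_of_smul_eq_neg (by norm_num) (neg_two_smul_half_smul c) ch,
    twist_firstChern_eq_zero_of_smul_eq_neg (neg_two_smul_half_smul c)⟩

end KappaClass

end Summit.Ventures.HSemireg
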